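import Literature.NumberTheory.K2Lit.DoubledUnitaryDegeneratePrincipalSeries      -- ★ D1 `localSiegelCharacter`, `absDetDelta` (p854713)
import Literature.NumberTheory.GelbartRogawski1991.LocalDoubledUnitarySiegel       -- ★ `isSiegelDelta_iff_blocks`, `IsSiegelDelta.mul/inv`
import HarnessLib

/-!
# `K2LiuLocalSiegelCharacterMul` — the inducing character `χ_v(det_Δ ·)|det_Δ ·|_v^{s+n/2}` is multiplicative on `P_Δ(F_v)`
# (socket #7c `sig_K2LiuLocalSiegelCharacterMul` of `Cruxes/HLiu418/Lines/K2_Liu_CurveThetaSigs_U3c_LocalSiegel.lean`)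

Track B ∕ K2-LIT, crux hLiu418 = `stmt-HodgeConjecture-24832`, route of record `HCCMUnconditional`; unit U3c «LOCAL SIEGEL»;
prover seat `hodgecm-mathlib-K2Liu-p04` (g0); lane `--supports stmt-HodgeConjecture-24832 --as helper` (count-neutral).
THEOREMS ONLY (no `def`, no `instance`, no notation, no named-fact hypothesis, no `sorry`).

**Statement proved (bytes of the socket, frozen).** General quadratic `E∕F`, `c`, `δ`, finite `v`, symmetric `T₀`,
`J^𝔻 = (T₀ ⊕ −T₀) ⊗ 1`: for `p, q ∈ P_Δ(F_v)` (★ `IsSiegelDelta`), every family `χ_w : E_wˣ →* ℂˣ` and `s ∈ ℂ`,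
`localSiegelCharacter χ_v s (p q) = localSiegelCharacter χ_v s p · localSiegelCharacter χ_v s q`
([HarrisKudlaSweet1996, §1 (1.15)] «χ(x(p₁p₂)) = χ(x(p₁))χ(x(p₂))»; [Kudla1994, §3]).

**Proof.** The LOCAL twins (rank-generic `n`, any place `v`) of the ★ global `GRConstruction.deltaBlock_mul ∕ detDelta_mul ∕
chiDet_mul` (`DoubledUnitarySiegelParabolicAlgebra`), proved directly in the `(𝕍, −𝕍)`-blocks:
* `toBlocks_mul_add_of_blocks_eq` — for block matrices `M, N` on `ι ⊕ ι` with `N₁₁ + N₁₂ = N₂₁ + N₂₂` (the Siegel block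
  condition of ★ `isSiegelDelta_iff_blocks`), `(MN)₁₁ + (MN)₁₂ = (M₁₁ + M₁₂)(N₁₁ + N₁₂)`;
* `deltaBlock_mul` (`det_Δ`-block of a product, needs only `q ∈ P_Δ`), `deltaBlock_one`, `detDelta_mul`,
  `isUnit_detDelta` (`det_Δ p_w ∈ E_wˣ` on `P_Δ`, via `p · p⁻¹ = 1` — the tree had this only in rank one,
  ★ `isUnit_detDelta_of_isSiegelDelta`), `absDetDelta_mul`, `chiDet_mul` (the `dite` on units resolves on `P_Δ`),
  `localSiegelCharacter_mul` (`Complex.mul_cpow_ofReal_nonneg`), and the socket `K2LiuLocalSiegelCharacterMul`.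

HONEST LABEL: HC_CM is proved only modulo the 7 printed citations (2 remaining named inputs:
hLiu418 = stmt-HodgeConjecture-24832, h413 = stmt-HodgeConjecture-24833) until rung 0 closes; this file is
road-independent scaffold (#7c of the SIG TABLE `Cruxes/HLiu418/Lines/K2_Liu_CurveThetaSigs.md`) and moves no counter.

## References
* [HarrisKudlaSweet1996] M. Harris, S. Kudla, W. J. Sweet, *Theta dichotomy for unitary groups*, JAMS 9 (1996), §1 (1.11)–(1.15).
* [Kudla1994] S. Kudla, *Splitting metaplectic covers of dual reductive pairs*, Israel J. Math. 87 (1994), §3.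
* [Liu2021] Y. Liu, *Fourier–Jacobi cycles and arithmetic relative trace formula*, §B.3 p. 101 (`J_a(s, μᶜ)`).
-/

set_option autoImplicit false
-- the mandated namespace repeats the single-problem summit's segment (`HodgeConjecture.HodgeConjecture`)
set_option linter.dupNamespace false

namespace Summit.HodgeConjecture.HodgeConjecture.Cruxes.HLiu418.K2LiuLocalSiegel

open NumberField IsDedekindDomain
open Literature.NumberTheory.Automorphic Literature.NumberTheory.Automorphic.UnitaryGroup
open Literature.NumberTheory.GelbartRogawski1991.UnitaryDualPair.LocalSplitting
open Literature.NumberTheory.K2Lit.LocalSiegelDoubled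

/-! ## Block algebra on `ι ⊕ ι` -/

/-- **`(MN)₁₁ + (MN)₁₂ = (M₁₁ + M₁₂)(N₁₁ + N₁₂)` when `N₁₁ + N₁₂ = N₂₁ + N₂₂`** (`N` stabilises the diagonal
`Δ = {(u, u)}`: the `Δ`-block of a product). [cite: Kudla1994, §3] -/
theorem toBlocks_mul_add_of_blocks_eq {R ι : Type*} [CommRing R] [Fintype ι] [DecidableEq ι]
    (M N : Matrix (ι ⊕ ι) (ι ⊕ ι) R) (hN : N.toBlocks₁₁ + N.toBlocks₁₂ = N.toBlocks₂₁ + N.toBlocks₂₂) :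
    (M * N).toBlocks₁₁ + (M * N).toBlocks₁₂ = (M.toBlocks₁₁ + M.toBlocks₁₂) * (N.toBlocks₁₁ + N.toBlocks₁₂) := by
  conv_lhs => rw [← Matrix.fromBlocks_toBlocks M, ← Matrix.fromBlocks_toBlocks N, Matrix.fromBlocks_multiply,
    Matrix.toBlocks_fromBlocks₁₁, Matrix.toBlocks_fromBlocks₁₂]
  rw [add_add_add_comm, ← Matrix.mul_add, ← Matrix.mul_add, ← hN, ← Matrix.add_mul]

/-- `reindex e e` is multiplicative. [folklore] -/
theorem reindex_mul_reindex {R m k : Type*} [CommRing R] [Fintype m] [Fintype k] (e : m ≃ k)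
    (M N : Matrix m m R) : Matrix.reindex e e (M * N) = Matrix.reindex e e M * Matrix.reindex e e N := by
  simp only [Matrix.reindex_apply, Matrix.submatrix_mul_equiv]

/-! ## `det_Δ` on the local Siegel parabolic `P_Δ(F_v)` -/

variable (F : Type) [Field F] [NumberField F] (E : Type) [Field E] [NumberField E] [Algebra F E]
  [Algebra.IsQuadraticExtension F E] (c : E ≃ₐ[F] E)
  {δ : E} (hcδ : c δ = -δ) (hδ : δ ≠ 0) {d : F} (hd : δ * δ = algebraMap F E d)
  (v : HeightOneSpectrum (𝓞 F)) (n : ℕ) {T₀ : Matrix (Fin n) (Fin n) F} (hT₀ : T₀.IsSymm)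
  {JD : Matrix (Fin (n + n)) (Fin (n + n)) E} (hJD : JD = (gramD F n T₀).map (algebraMap F E))

omit [Algebra.IsQuadraticExtension F E] in
/-- the `w`-component matrix of a product in `H(F_v) ≤ Π_{w ∣ v} GL_{2n}(E_w)` is the product of the components
(definitional). [folklore] -/
theorem coe_component_mul (p q : UnitaryGroup.localPi E c (n + n) JD v) (w : PlacesOver E v) :
    ((((p * q : UnitaryGroup.localPi E c (n + n) JD v) : UnitaryGroup.LocalGLPi E (n + n) v) w :
        GL (Fin (n + n)) (w.1.adicCompletion E)) : Matrix (Fin (n + n)) (Fin (n + n)) (w.1.adicCompletion E)) =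
      (((p : UnitaryGroup.LocalGLPi E (n + n) v) w : GL (Fin (n + n)) (w.1.adicCompletion E)) :
          Matrix (Fin (n + n)) (Fin (n + n)) (w.1.adicCompletion E)) *
        (((q : UnitaryGroup.LocalGLPi E (n + n) v) w : GL (Fin (n + n)) (w.1.adicCompletion E)) :
          Matrix (Fin (n + n)) (Fin (n + n)) (w.1.adicCompletion E)) :=
  rfl

omit [Algebra.IsQuadraticExtension F E] in
/-- `det_Δ`-block of the identity: `deltaBlock w 1 = 1`. [cite: Kudla1994, §3] -/
theorem deltaBlock_one (w : PlacesOver E v) :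
    deltaBlock F E c v n w (1 : UnitaryGroup.localPi E c (n + n) JD v) = 1 := by
  simp only [deltaBlock]
  rw [show ((((1 : UnitaryGroup.localPi E c (n + n) JD v) : UnitaryGroup.LocalGLPi E (n + n) v) w :
      GL (Fin (n + n)) (w.1.adicCompletion E)) : Matrix (Fin (n + n)) (Fin (n + n)) (w.1.adicCompletion E)) = 1
      from rfl, Matrix.reindex_apply, Matrix.submatrix_one_equiv, ← Matrix.fromBlocks_one,
    Matrix.toBlocks_fromBlocks₁₁, Matrix.toBlocks_fromBlocks₁₂, add_zero]

/-- **`deltaBlock w (p q) = deltaBlock w p · deltaBlock w q` for `q ∈ P_Δ(F_v)`** (local twin of ★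
`GRConstruction.deltaBlock_mul`; only `q` need stabilise `Δ`). [cite: Kudla1994, §3] [cite: HarrisKudlaSweet1996, §1 (1.15)] -/
theorem deltaBlock_mul (p q : UnitaryGroup.localPi E c (n + n) JD v)
    (hq : IsSiegelDelta F E c hcδ hδ hd v n hT₀ hJD q) (w : PlacesOver E v) :
    deltaBlock F E c v n w (p * q) = deltaBlock F E c v n w p * deltaBlock F E c v n w q := by
  have hq' := (isSiegelDelta_iff_blocks F E c hcδ hδ hd v n hT₀ hJD q).1 hq w
  simp only [deltaBlock]
  rw [coe_component_mul, reindex_mul_reindex]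
  exact toBlocks_mul_add_of_blocks_eq _ _ hq'

/-- **`det_Δ (p q)_w = det_Δ p_w · det_Δ q_w` for `q ∈ P_Δ(F_v)`** (local twin of ★ `GRConstruction.detDelta_mul`).
[cite: HarrisKudlaSweet1996, §1 (1.15)] [cite: Kudla1994, §3] -/
theorem detDelta_mul (p q : UnitaryGroup.localPi E c (n + n) JD v)
    (hq : IsSiegelDelta F E c hcδ hδ hd v n hT₀ hJD q) (w : PlacesOver E v) :
    detDelta F E c v n w (p * q) = detDelta F E c v n w p * detDelta F E c v n w q := by
  simp only [detDelta, deltaBlock_mul F E c hcδ hδ hd v n hT₀ hJD p q hq w, Matrix.det_mul]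

/-- **`det_Δ p_w ∈ E_wˣ` for `p ∈ P_Δ(F_v)`**, any rank `n`, any place (`det_Δ p · det_Δ p⁻¹ = det_Δ 1 = 1`; the tree's ★
`isUnit_detDelta_of_isSiegelDelta` is the rank-one CM case). [cite: Kudla1994, §3] [cite: HarrisKudlaSweet1996, §1 (1.15)] -/
theorem isUnit_detDelta (p : UnitaryGroup.localPi E c (n + n) JD v)
    (hp : IsSiegelDelta F E c hcδ hδ hd v n hT₀ hJD p) (w : PlacesOver E v) :
    IsUnit (detDelta F E c v n w p) := by
  refine IsUnit.of_mul_eq_one (detDelta F E c v n w p⁻¹) ?_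
  rw [← detDelta_mul F E c hcδ hδ hd v n hT₀ hJD p p⁻¹ hp.inv w, mul_inv_cancel, detDelta, deltaBlock_one,
    Matrix.det_one]

/-- **`|det_Δ (p q)|_v = |det_Δ p|_v · |det_Δ q|_v` for `q ∈ P_Δ(F_v)`**. [cite: HarrisKudlaSweet1996, §1 (1.15)] -/
theorem absDetDelta_mul (p q : UnitaryGroup.localPi E c (n + n) JD v)
    (hq : IsSiegelDelta F E c hcδ hδ hd v n hT₀ hJD q) :
    absDetDelta F E c v n (p * q) = absDetDelta F E c v n p * absDetDelta F E c v n q := by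
  simp only [absDetDelta, detDelta_mul F E c hcδ hδ hd v n hT₀ hJD p q hq, norm_mul, Finset.prod_mul_distrib]

/-- **`χ_v(det_Δ (p q)) = χ_v(det_Δ p) χ_v(det_Δ q)` on `P_Δ(F_v)`** (local twin of ★ `GRConstruction.chiDet_mul`; both
determinants are units by `isUnit_detDelta`, so the `dite` in ★ `chiDet` resolves). [cite: HarrisKudlaSweet1996, §1 (1.15)] -/
theorem chiDet_mul (χv : ∀ w : PlacesOver E v, (w.1.adicCompletion E)ˣ →* ℂˣ)
    (p q : UnitaryGroup.localPi E c (n + n) JD v)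
    (hp : IsSiegelDelta F E c hcδ hδ hd v n hT₀ hJD p) (hq : IsSiegelDelta F E c hcδ hδ hd v n hT₀ hJD q) :
    chiDet F E c v n χv (p * q) = chiDet F E c v n χv p * chiDet F E c v n χv q := by
  unfold chiDet
  rw [← Finset.prod_mul_distrib]
  refine Finset.prod_congr rfl fun w _ => ?_
  have hu := isUnit_detDelta F E c hcδ hδ hd v n hT₀ hJD (p * q) (hp.mul hq) w
  have hu₁ := isUnit_detDelta F E c hcδ hδ hd v n hT₀ hJD p hp w
  have hu₂ := isUnit_detDelta F E c hcδ hδ hd v n hT₀ hJD q hq w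
  rw [dif_pos hu, dif_pos hu₁, dif_pos hu₂, ← map_mul]
  congr 1
  apply Units.ext
  rw [Units.val_mul, hu.unit_spec, hu₁.unit_spec, hu₂.unit_spec]
  exact detDelta_mul F E c hcδ hδ hd v n hT₀ hJD p q hq w

/-- **The inducing character is multiplicative on `P_Δ(F_v)`**:
`localSiegelCharacter χ_v s (p q) = localSiegelCharacter χ_v s p · localSiegelCharacter χ_v s q` for `p, q ∈ P_Δ(F_v)`.
[cite: HarrisKudlaSweet1996, §1 (1.15)] [cite: Liu2021, §B.3 p. 101] -/
theorem localSiegelCharacter_mul (χv : ∀ w : PlacesOver E v, (w.1.adicCompletion E)ˣ →* ℂˣ) (s : ℂ)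
    (p q : UnitaryGroup.localPi E c (n + n) JD v)
    (hp : IsSiegelDelta F E c hcδ hδ hd v n hT₀ hJD p) (hq : IsSiegelDelta F E c hcδ hδ hd v n hT₀ hJD q) :
    localSiegelCharacter F E c v n χv s (p * q) =
      localSiegelCharacter F E c v n χv s p * localSiegelCharacter F E c v n χv s q := by
  simp only [localSiegelCharacter]
  rw [chiDet_mul F E c hcδ hδ hd v n hT₀ hJD χv p q hp hq, absDetDelta_mul F E c hcδ hδ hd v n hT₀ hJD p q hq,
    Units.val_mul, Complex.ofReal_mul,
    Complex.mul_cpow_ofReal_nonneg (absDetDelta_nonneg F E c v n p) (absDetDelta_nonneg F E c v n q)]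
  ring

end Summit.HodgeConjecture.HodgeConjecture.Cruxes.HLiu418.K2LiuLocalSiegel

/-! ## The socket -/

namespace Summit.HodgeConjecture.HodgeConjecture.Cruxes.HLiu418

open NumberField IsDedekindDomain MeasureTheory
open Literature.NumberTheory.Automorphic Literature.NumberTheory.Automorphic.UnitaryGroup
open Literature.NumberTheory.GelbartRogawski1991.UnitaryDualPair.LocalSplitting
open Literature.NumberTheory.K2Lit.LocalSiegelDoubled

/-- **Socket #7c `sig_K2LiuLocalSiegelCharacterMul` (bytes of `Cruxes/HLiu418/Lines/K2_Liu_CurveThetaSigs_U3c_LocalSiegel.lean`,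
frozen), PROVED.** General quadratic `E∕F`, `c`, `δ`, finite `v`, symmetric `T₀`, `J^𝔻 = (T₀ ⊕ −T₀) ⊗ 1`: for
`p, q ∈ P_Δ(F_v)` (★ `IsSiegelDelta`) and every family `χ_w : E_wˣ →* ℂˣ`, `s ∈ ℂ`, the character inducing `I_v(s, χ_v)`
satisfies `localSiegelCharacter χ_v s (p q) = localSiegelCharacter χ_v s p · localSiegelCharacter χ_v s q` — from
`det_Δ(pq)_w = det_Δ(p)_w det_Δ(q)_w` (the `Δ`-block of a product of two stabilisers of `Δ`) and `IsUnit (det_Δ p_w)` on `P_Δ`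
(`K2LiuLocalSiegel.localSiegelCharacter_mul`). [cite: HarrisKudlaSweet1996, §1 (1.15)] [cite: Kudla1994, §3] -/
theorem K2LiuLocalSiegelCharacterMul : ∀ (F : Type) [Field F] [NumberField F] (E : Type) [Field E] [NumberField E] [Algebra F E]
    [Algebra.IsQuadraticExtension F E] (c : E ≃ₐ[F] E) {δ : E} (hcδ : c δ = -δ) (hδ : δ ≠ 0) {d : F} (hd : δ * δ = algebraMap F E d)
    (v : HeightOneSpectrum (𝓞 F)) (n : ℕ) {T₀ : Matrix (Fin n) (Fin n) F} (hT₀ : T₀.IsSymm)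
    {JD : Matrix (Fin (n + n)) (Fin (n + n)) E} (hJD : JD = (gramD F n T₀).map (algebraMap F E))
    (χv : ∀ w : UnitaryGroup.PlacesOver E v, (w.1.adicCompletion E)ˣ →* ℂˣ) (s : ℂ)
    (p q : UnitaryGroup.localPi E c (n + n) JD v),
    IsSiegelDelta F E c hcδ hδ hd v n hT₀ hJD p → IsSiegelDelta F E c hcδ hδ hd v n hT₀ hJD q →
      localSiegelCharacter F E c v n χv s (p * q) =
        localSiegelCharacter F E c v n χv s p * localSiegelCharacter F E c v n χv s q := by
  intro F _ _ E _ _ _ _ c δ hcδ hδ d hd v n T₀ hT₀ JD hJD χv s p q hp hq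
  exact K2LiuLocalSiegel.localSiegelCharacter_mul F E c hcδ hδ hd v n hT₀ hJD χv s p q hp hq

end Summit.HodgeConjecture.HodgeConjecture.Cruxes.HLiu418
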